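import Literature.Barriers.RiemannHypothesis.JensenPolynomialsKimProofs
import Literature.Analysis.Complex.JensenPolynomialSectorGenusOne
import HarnessLib

/-!
# Proof of Kim's corollary (Farmer 2022, §2): large-shift Jensen polynomials are hyperbolic

Sibling ("Proofs") file of `Literature/Barriers/RiemannHypothesis/JensenPolynomials.lean`. It
discharges the named fact `Literature.Barriers.RiemannHypothesis.Farmer2022_kimCorollary`
(`Farmer2022_kimCorollary_holds`):

> "A corollary [of Kim's theorem] is that for any `d`, if `n` is large enough then the classical
> Jensen polynomial `J^{d,n}_{f,cl}` has only real zeros" (Farmer 2022, §2, for `f` entire of order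
> `< 2`, real on the real axis, with all zeros in a strip `|Im z| < A`).

Farmer prints no proof. The statement is (the qualitative part of) **Kim–Lee 2021, Theorem 1**:
"Suppose that `f` is a transcendental real entire function of order `ρ < 2` and `Z(f) ⊂ 𝕊`. Then for
every `c > ρ` we have `N(f; d) = O(d^{c/2})` as `d → ∞`", `N(f; d)` being the least `N` with
`J(f⁽ⁿ⁾; d)` hyperbolic for all `n ≥ N`; their proof combines Kim's theorem (their Thm. 2),
Obreschkoff's theorem (their Thm. 3 and Corollary) and real polynomial approximants with
`Z(P_k) ⊂ Z(f⁽ⁿ⁾) ∪ ℝ`. All three ingredients are theorems of the tree: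

* Kim's theorem in Farmer's local form, `Farmer2022_kimTheorem_holds`
  (`JensenPolynomialsKimProofs.lean`): for `n ≥ N(R)` the zeros of `f⁽ⁿ⁾` in `|z| < R` are real;
* the zeros of every `f⁽ⁿ⁾` stay in the strip (`Literature.Analysis.Complex.abs_im_le_of_iteratedDeriv_eq_zero`),
  so for `R = √d Δ + 2` every zero `a` of `f⁽ⁿ⁾` is real or satisfies `|Im a| ≤ |a|/√d`, i.e. lies in
  Kim–Lee's sector `S(1/√d)` — even after a real translation by `|c| ≤ 1`;
* `Literature.Analysis.Complex.KimLee.splits_jensenPoly_taylor_of_zeros_mem_sector_two`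
  (`JensenPolynomialSectorGenusOne.lean`: Obreschkoff's theorem, the Taylor shift for the factor
  `e^{βz}`, and a Hadamard-free local approximation by `e^{βz} P(z)`): for a real entire `h` of order
  `< 2` with `h(0) ≠ 0` and zeros in `S(δ)`, `d δ² ≤ 1`, `J(h; d)` is hyperbolic. The case `h(0) = 0` is
  reduced to it by the real translations `h(· + c)`, `c → 0` (`splits_jensenPoly_of_strip`).

Finally `J^{d,n}_{f,cl} = J(f⁽ⁿ⁾; d)` (`classicalJensenPoly_eq`), and a polynomial `f` (some
`f⁽ⁿ⁾ ≡ 0`) has `J^{d,n}_{f,cl} = 0` for large `n`.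

## References

* [Farmer2022] D. W. Farmer, *Jensen polynomials are not a plausible route to proving the Riemann
  hypothesis*, Adv. Math. 411 (2022), 108781 = arXiv:2008.07206, §2 (read: pp. 3–5).
* [KimLee2021] Y.-O. Kim, J. Lee, *A note on the zeros of Jensen polynomials*, arXiv:2105.05386,
  Thm. 1 and its proof (read: pp. 1–2).
* [Kim1996] Y.-O. Kim, Proc. AMS 124 (1996), 819–830, Thm. 2 (cited through Farmer 2022 §2 and
  Kim–Lee 2021, Thm. 2; paywalled, not read).
-/

noncomputable section

open Complex Filter Metric Set Topology Polynomial
open scoped ComplexConjugate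

namespace Literature.Barriers.RiemannHypothesis

open Literature.Analysis.Complex Literature.Analysis.Complex.KimLee Literature.Analysis.Complex.Obreschkoff
  Literature.Analysis.Complex.PolyaSchur Literature.Analysis.TotalPositivity

/-! ## Jensen polynomials: shifts and derivatives -/

/-- The shift rule for sequences: `J^{d,n}_a = J^{d,0}_{a(n + ·)}`. [folklore] -/
theorem jensenPoly_shift (a : ℕ → ℝ) (d n : ℕ) :
    Literature.NumberTheory.LFunctions.jensenPoly a d n =
      Literature.NumberTheory.LFunctions.jensenPoly (fun k => a (n + k)) d 0 := by
  ext j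
  simp only [PolyaSchur.coeff_jensenPoly, zero_add]

/-- `f⁽ⁿ⁺ᵏ⁾ = (f⁽ⁿ⁾)⁽ᵏ⁾`. [folklore] -/
theorem iteratedDeriv_add_eq (f : ℂ → ℂ) (n k : ℕ) :
    iteratedDeriv (n + k) f = iteratedDeriv k (iteratedDeriv n f) := by
  rw [iteratedDeriv_eq_iterate, iteratedDeriv_eq_iterate, iteratedDeriv_eq_iterate, add_comm,
    Function.iterate_add_apply]

/-- **`J^{d,n}_{f,cl} = J(f⁽ⁿ⁾; d)`:** the classical Jensen polynomial of degree `d` and shift `n` of `f`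
is the degree-`d` Jensen polynomial of the Taylor sequence of `f⁽ⁿ⁾` (Farmer 2022, (2.2): "the
`d`th classical Jensen polynomial for the `n`th derivative of `f`"). [cite: Farmer2022, §2 eq. (2.2)] -/
theorem classicalJensenPoly_eq (f : ℂ → ℂ) (d n : ℕ) :
    classicalJensenPoly f d n =
      Literature.NumberTheory.LFunctions.jensenPoly
        (fun k => (iteratedDeriv k (iteratedDeriv n f) 0).re) d 0 := by
  rw [classicalJensenPoly, jensenPoly_shift]
  congr 1
  funext k
  rw [taylorCoeffSeq, iteratedDeriv_add_eq]

/-- All derivatives of the zero function vanish. [folklore] -/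
theorem iteratedDeriv_zero_fun (k : ℕ) : iteratedDeriv k (0 : ℂ → ℂ) = 0 := by
  induction k with
  | zero => simp
  | succ k ih =>
    rw [iteratedDeriv_succ, ih]
    funext z
    simp

/-- If `f⁽ⁿ⁾ ≡ 0` then `J^{d,m}_{f,cl} = 0` for `m ≥ n`. [folklore] -/
theorem classicalJensenPoly_eq_zero_of_iteratedDeriv_eq_zero {f : ℂ → ℂ} {n : ℕ}
    (hn : iteratedDeriv n f = 0) (d : ℕ) {m : ℕ} (hm : n ≤ m) : classicalJensenPoly f d m = 0 := by
  rw [classicalJensenPoly_eq]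
  obtain ⟨j, rfl⟩ := Nat.exists_eq_add_of_le hm
  rw [iteratedDeriv_add_eq, hn, iteratedDeriv_zero_fun]
  ext i
  simp only [PolyaSchur.coeff_jensenPoly, coeff_zero, iteratedDeriv_zero_fun, Pi.zero_apply,
    zero_re, mul_zero, ite_self]

/-! ## From the strip to the sector -/

/-- A degree-`0` Jensen polynomial is a constant, hence hyperbolic. [folklore] -/
theorem splits_jensenPoly_zero_degree (a : ℕ → ℝ) :
    (Literature.NumberTheory.LFunctions.jensenPoly a 0 0).Splits :=
  Splits.of_natDegree_eq_zero (Nat.le_zero.1 (PolyaSchur.natDegree_jensenPoly_le a 0 0))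

/-- **Far non-real zeros in a strip lie in a thin sector.** If `h` is a real entire function of
order `< 2` with `h(0) ≠ 0`, all of whose zeros satisfy `|Im z| ≤ Δ`, whose zeros in `|z| < R₀` are
real, and `d Δ² ≤ R₀²` (`R₀ ≥ 0`), then every zero lies in Kim–Lee's sector `S(1/√d)` and hence
`J(h; d)` is hyperbolic (`KimLee.splits_jensenPoly_taylor_of_zeros_mem_sector_two`).
[cite: KimLee2021, proof of Theorem 1] -/
theorem splits_jensenPoly_of_strip_of_apply_zero_ne {h : ℂ → ℂ} (hh : Differentiable ℂ h)
    {ρ C : ℝ} (hρ0 : 0 ≤ ρ) (hρ : ρ < 2) (hgr : ∀ z, ‖h z‖ ≤ C * Real.exp (‖z‖ ^ ρ))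
    (hreal : ∀ x : ℝ, (h x).im = 0) (h0 : h 0 ≠ 0) {Δ R₀ : ℝ} (hR₀ : 0 ≤ R₀)
    (hstrip : ∀ z, h z = 0 → |z.im| ≤ Δ) (hnear : ∀ z, h z = 0 → ‖z‖ < R₀ → z.im = 0)
    {d : ℕ} (hdΔ : (d : ℝ) * Δ ^ 2 ≤ R₀ ^ 2) :
    (Literature.NumberTheory.LFunctions.jensenPoly (fun k => (iteratedDeriv k h 0).re) d 0).Splits := by
  rcases Nat.eq_zero_or_pos d with rfl | hdpos
  · exact splits_jensenPoly_zero_degree _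
  have hdR : (0 : ℝ) < d := by exact_mod_cast hdpos
  set s : ℝ := Real.sqrt d with hs
  have hs0 : 0 < s := Real.sqrt_pos.2 hdR
  have hs2 : s ^ 2 = d := Real.sq_sqrt hdR.le
  set δ : ℝ := s⁻¹ with hδ
  have hdδ : (d : ℝ) * δ ^ 2 ≤ 1 := by
    rw [hδ, inv_pow, hs2, mul_inv_cancel₀ hdR.ne']
  -- `√d Δ ≤ R₀`
  have hΔ : s * Δ ≤ R₀ := by
    by_cases hΔ0 : Δ ≤ 0
    · exact (mul_nonpos_of_nonneg_of_nonpos hs0.le hΔ0).trans hR₀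
    · have : (s * Δ) ^ 2 ≤ R₀ ^ 2 := by rw [mul_pow, hs2]; exact hdΔ
      exact (abs_le_of_sq_le_sq' this hR₀).2
  have hzero : ∀ z : ℂ, h z = 0 → z ∈ sector δ := fun z hz => by
    rw [mem_sector]
    by_cases hzR : ‖z‖ < R₀
    · rw [hnear z hz hzR, abs_zero]; positivity
    · push Not at hzR
      have h1 : |z.im| ≤ Δ := hstrip z hz
      have h2 : Δ ≤ δ * ‖z‖ := by
        rw [hδ, ← div_eq_inv_mul, le_div_iff₀ hs0]
        calc Δ * s = s * Δ := mul_comm _ _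
          _ ≤ R₀ := hΔ
          _ ≤ ‖z‖ := hzR
      exact h1.trans h2
  exact splits_jensenPoly_taylor_of_zeros_mem_sector_two hh hρ0 hρ hgr (apply_conj_eq_conj hh hreal)
    h0 hzero hdδ

/-- **Hyperbolicity of `J(h; d)` for a real entire `h` of order `< 2` whose non-real zeros are far
away in a strip** — with no assumption at `0`: if all zeros of `h` satisfy `|Im z| ≤ Δ`, those with
`|z| < R₀` are real, `R₀ ≥ 1` and `d Δ² ≤ (R₀ − 1)²`, then `J(h; d)` has only real zeros. (If
`h(0) = 0`, apply the previous theorem to the real translates `h(· + c)`, `0 < |c| ≤ 1`, `h(c) ≠ 0`,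
whose Taylor coefficients at `0` are those of `h` at `c`, and let `c → 0`:
`PolyaSchur.splits_of_tendsto_coeff`.) [cite: KimLee2021, proof of Theorem 1] -/
theorem splits_jensenPoly_of_strip {h : ℂ → ℂ} (hh : Differentiable ℂ h)
    {ρ C : ℝ} (hρ0 : 0 ≤ ρ) (hρ : ρ < 2) (hgr : ∀ z, ‖h z‖ ≤ C * Real.exp (‖z‖ ^ ρ))
    (hreal : ∀ x : ℝ, (h x).im = 0) {Δ R₀ : ℝ} (hR₀ : 1 ≤ R₀)
    (hstrip : ∀ z, h z = 0 → |z.im| ≤ Δ) (hnear : ∀ z, h z = 0 → ‖z‖ < R₀ → z.im = 0)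
    {d : ℕ} (hdΔ : (d : ℝ) * Δ ^ 2 ≤ (R₀ - 1) ^ 2) :
    (Literature.NumberTheory.LFunctions.jensenPoly (fun k => (iteratedDeriv k h 0).re) d 0).Splits := by
  classical
  -- the identically-zero function
  by_cases hzf : ∀ z, h z = 0
  · have h0fun : h = 0 := funext hzf
    have : Literature.NumberTheory.LFunctions.jensenPoly (fun k => (iteratedDeriv k h 0).re) d 0 = 0 := by
      ext i
      simp only [PolyaSchur.coeff_jensenPoly, coeff_zero, h0fun, iteratedDeriv_zero_fun,
        Pi.zero_apply, zero_re, mul_zero, ite_self]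
    rw [this]; exact Splits.zero
  -- `h ≠ 0` near `0`, off `0`
  have hev : ∀ᶠ w in 𝓝[≠] (0 : ℂ), h w ≠ 0 := by
    rcases (hh.analyticAt 0).eventually_eq_zero_or_eventually_ne_zero with h1 | h1
    · exfalso
      apply hzf
      intro z
      exact (hh.differentiableOn.analyticOnNhd isOpen_univ).eqOn_zero_of_preconnected_of_eventuallyEq_zero
        isPreconnected_univ (mem_univ 0) h1 (mem_univ z)
    · exact h1
  have hevR : ∀ᶠ c : ℝ in 𝓝[≠] (0 : ℝ), h (c : ℂ) ≠ 0 := tendsto_ofReal_nhdsNE_zero.eventually hev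
  have hsmall : ∀ᶠ c in 𝓝[≠] (0 : ℝ), |c| ≤ 1 := by
    have : ∀ᶠ c in 𝓝 (0 : ℝ), |c| ≤ 1 := by
      filter_upwards [Metric.closedBall_mem_nhds (0 : ℝ) one_pos] with c hc
      simpa [Real.norm_eq_abs] using hc
    exact this.filter_mono nhdsWithin_le_nhds
  -- a uniform growth bound for the translates `h(· + c)`, `|c| ≤ 1`
  obtain ⟨K, -, hK⟩ := exists_add_rpow_le ρ 1 hρ0 hρ zero_le_one
  have hC : 0 ≤ C := growthConst_nonneg hgr
  have hgrc : ∀ c : ℝ, |c| ≤ 1 → ∀ z : ℂ,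
      ‖h (z + c)‖ ≤ C * Real.exp K * Real.exp (‖z‖ ^ ((ρ + 2) / 2)) := by
    intro c hc z
    have h1 : ‖z + (c : ℂ)‖ ≤ ‖z‖ + 1 := by
      calc ‖z + (c : ℂ)‖ ≤ ‖z‖ + ‖(c : ℂ)‖ := norm_add_le _ _
        _ ≤ ‖z‖ + 1 := by rw [Complex.norm_real, Real.norm_eq_abs]; linarith
    calc ‖h (z + c)‖ ≤ C * Real.exp (‖z + (c : ℂ)‖ ^ ρ) := hgr _
      _ ≤ C * Real.exp ((‖z‖ + 1) ^ ρ) := by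
          gcongr
      _ ≤ C * Real.exp (K + ‖z‖ ^ ((ρ + 2) / 2)) := by
          gcongr
          exact hK ‖z‖ (norm_nonneg z)
      _ = C * Real.exp K * Real.exp (‖z‖ ^ ((ρ + 2) / 2)) := by rw [Real.exp_add]; ring
  have hρ' : (ρ + 2) / 2 < 2 := by linarith
  have hρ'0 : 0 ≤ (ρ + 2) / 2 := by linarith
  -- the Jensen polynomials of the translates split
  set P : ℝ → ℝ[X] := fun c => Literature.NumberTheory.LFunctions.jensenPoly
    (fun k => (iteratedDeriv k (fun z => h (z + c)) 0).re) d 0 with hPdef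
  have hsplit : ∀ᶠ c in 𝓝[≠] (0 : ℝ), (P c).Splits := by
    filter_upwards [hevR, hsmall] with c hc0 hc1
    have hhc : Differentiable ℂ fun z => h (z + c) := hh.comp (differentiable_id.add_const _)
    refine splits_jensenPoly_of_strip_of_apply_zero_ne hhc hρ'0 hρ' (hgrc c hc1) (fun x => ?_)
      (by simpa using hc0) (R₀ := R₀ - 1) (by linarith) (fun z hz => ?_) (fun z hz hzR => ?_) hdΔ
    · have : ((x : ℂ) + c) = ((x + c : ℝ) : ℂ) := by push_cast; ring
      rw [this]; exact hreal _
    · have := hstrip _ hz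
      simpa using this
    · have h1 : ‖z + (c : ℂ)‖ < R₀ := by
        calc ‖z + (c : ℂ)‖ ≤ ‖z‖ + ‖(c : ℂ)‖ := norm_add_le _ _
          _ < (R₀ - 1) + 1 := by
              rw [Complex.norm_real, Real.norm_eq_abs]
              linarith
          _ = R₀ := by ring
      have := hnear _ hz h1
      simpa using this
  -- their coefficients converge to those of `J(h; d)` as `c → 0`
  have hcoef : ∀ m, Tendsto (fun c : ℝ => (iteratedDeriv m (fun z => h (z + c)) 0).re) (𝓝[≠] 0)
      (𝓝 ((iteratedDeriv m h 0).re)) := fun m => by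
    have h1 : ∀ c : ℝ, iteratedDeriv m (fun z => h (z + c)) 0 = iteratedDeriv m h c := fun c => by
      rw [iteratedDeriv_comp_add_const]; simp
    simp only [h1]
    have hcont : Continuous fun c : ℝ => (iteratedDeriv m h c).re :=
      continuous_re.comp ((differentiable_iteratedDeriv hh m).continuous.comp continuous_ofReal)
    have := hcont.tendsto 0
    simp only [ofReal_zero] at this
    exact this.mono_left nhdsWithin_le_nhds
  refine splits_of_tendsto_coeff (l := 𝓝[≠] (0 : ℝ)) (P := P) (N := d)
    (fun c => PolyaSchur.natDegree_jensenPoly_le _ _ _) (PolyaSchur.natDegree_jensenPoly_le _ _ _)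
    (fun j => ?_) hsplit
  by_cases hj : j ≤ d
  · simp only [hPdef, PolyaSchur.coeff_jensenPoly, if_pos hj, zero_add]
    exact (hcoef j).const_mul _
  · simp only [hPdef, PolyaSchur.coeff_jensenPoly, if_neg hj]
    exact tendsto_const_nhds

/-! ## Kim's corollary -/

/-- **Kim's corollary holds** (Farmer 2022, §2; = Kim–Lee 2021, Thm. 1, qualitative part): for `f`
entire of order `< 2`, real on the real axis, with all zeros in a horizontal strip, and every degree
`d`, the classical Jensen polynomials `J^{d,n}_{f,cl}` are hyperbolic for all large `n`. Proof: if some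
derivative of `f` vanishes identically the polynomials vanish for large `n`; otherwise Kim's theorem
(`Farmer2022_kimTheorem_holds`) makes the zeros of `f⁽ⁿ⁾` in `|z| < √d Δ + 2` real for `n ≥ N`, the
zeros of `f⁽ⁿ⁾` stay in the strip `|Im z| ≤ Δ`, and `splits_jensenPoly_of_strip` applies to
`h = f⁽ⁿ⁾` (real entire of order `< 2`), with `J^{d,n}_{f,cl} = J(f⁽ⁿ⁾; d)`.
[cite: Farmer2022, §2] [cite: KimLee2021, Theorem 1] -/
theorem Farmer2022_kimCorollary_holds : Farmer2022_kimCorollary := by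
  intro f hf d
  -- a polynomial `f`: the Jensen polynomials vanish for large `n`
  by_cases hpoly : ∃ n, iteratedDeriv n f = 0
  · obtain ⟨n, hn⟩ := hpoly
    exact ⟨n, fun m hm => by
      rw [classicalJensenPoly_eq_zero_of_iteratedDeriv_eq_zero hn d hm]; exact Splits.zero⟩
  push Not at hpoly
  obtain ⟨hford, hrealf, Δ₀, hstrip₀⟩ := hf
  have hdiff : Differentiable ℂ f := hford.1
  obtain ⟨ρ, C, hρ0, hρ, hgr⟩ := exists_growth_nonneg hford
  set Δ : ℝ := max Δ₀ 0 with hΔdef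
  have hΔ : 0 ≤ Δ := le_max_right _ _
  have hstrip : ∀ z, f z = 0 → |z.im| ≤ Δ := fun z hz => (hstrip₀ z hz).trans (le_max_left _ _)
  -- Kim's theorem with radius `R = √d Δ + 2`
  set R : ℝ := Real.sqrt d * Δ + 2 with hRdef
  have hR : 0 < R := by positivity
  obtain ⟨N, hN⟩ := Farmer2022_kimTheorem_holds f ⟨hford, hrealf, Δ₀, hstrip₀⟩ hpoly R hR
  refine ⟨N, fun n hn => ?_⟩
  rw [classicalJensenPoly_eq]
  -- `h = f⁽ⁿ⁾` is real entire of order `< 2`, zeros in the strip, near zeros real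
  obtain ⟨ρ', C', hρ'0, hρ', hgr'⟩ := exists_growth_iteratedDeriv hdiff hρ0 hρ hgr n
  refine splits_jensenPoly_of_strip (differentiable_iteratedDeriv hdiff n) hρ'0 hρ' hgr'
    (im_iteratedDeriv_ofReal hdiff hrealf n) (R₀ := R)
    (by have := mul_nonneg (Real.sqrt_nonneg (d : ℝ)) hΔ; rw [hRdef]; linarith)
    (fun z hz => abs_im_le_of_iteratedDeriv_eq_zero hdiff hρ0 hρ hgr hrealf hpoly hΔ hstrip n hz)
    (fun z hz hzR => hN n hn z hzR hz) ?_
  rw [hRdef, add_sub_assoc, show (2 : ℝ) - 1 = 1 by norm_num]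
  have hs : Real.sqrt d ^ 2 = d := Real.sq_sqrt (Nat.cast_nonneg d)
  nlinarith [Real.sqrt_nonneg d, hs]

end Literature.Barriers.RiemannHypothesis
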